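import Summits.BirchSwinnertonDyer.BirchSwinnertonDyer.Theorems.AdditiveBranchIMCMultLowerCongruence
import HarnessLib

/-!
# The two vendored shapes of EPW's statement 5.1.1 on the branch `ω^{(p−1)/2}` agree at a GOOD ORDINARY
# curve: `BranchCharIdealMuZeroEigen` (raw Kato-component binders, k1-c2's `BranchTransfer.lean`) ↔
# `BranchCharIdealMuZeroHalfEigen` (half-eigen `EigenSelmerDualData`, this seat's `BranchTransferSemistable.lean`)

Cell `bsd-addord`, seat `bsd-addord-k1-c4` (D-0074 row B3), gen 3; bookkeeping sequel of
`AdditiveBranchIMCMultLowerCongruence`. HONEST FRAMING: pure vocabulary plumbing between two `def … : Prop`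
shapes of the SAME printed statement (EPW 2006 statement 5.1.1 with `μ = 0` for `f_V ⊗ ω^m`); nothing is
asserted about any curve, no fact is introduced, nothing is booked.

WHY. The cell now holds two Emerton–Pollack–Weston roads on the branch: k1-c2's (`cor514_branchTransfer_of_torsionIso`,
GOOD ORDINARY members, shape `BranchCharIdealMuZeroEigen V p` over the raw binders `(S, X, toDual, …)` of
`Kato2004.charIdeal_dvd_padicLFunctionBranch_component_of_surjective`) and this seat's
(`cor514_branchTransfer_semistable_of_torsionIso`, SEMISTABLE members, shape `BranchCharIdealMuZeroHalfEigen V p` over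
`WeierstrassCurve.EigenSelmerDualData` with the three-way branch disjunction). At a good ordinary `V` the two shapes
say the same thing: the raw subgroup `S` with its membership clause IS `eigenSelmerGroupOver` (the `χ_K`-eigenspace,
`(if g ∈ Gal(ℚ̄/K) then 1 else −1) • t = if … then t else −t`), and the multiplicative disjuncts are void
(`not_mult_of_good`). Consequently a partner certified in either currency (k1-c2's
`branchCharIdealMuZeroEigen_of_katoComponent_of_LValueUnit`, or §1 of `…MultLowerCongruence`) feeds either
transfer — in particular a good ordinary partner of k1-c2's road reaches a MULTIPLICATIVE twist model through
`quadraticBranchLowerDivisibilityAt_of_branchTransferSemistable` (§2 below).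

References: Emerton–Pollack–Weston 2006 statement 5.1.1, Cor. 5.1.4 [EmertonPollackWeston2006]; Kato 2004
Thm. 17.4 (3) [Kato2004Asterisque]; Wuthrich 2014 §3 [Wuthrich2014]; Greenberg LNM 1716 §5 [GreenbergLNM1716].
-/

set_option autoImplicit false
set_option linter.dupNamespace false

noncomputable section

open scoped Classical MatrixGroups ModularForm

open CongruenceSubgroup WeierstrassCurve
  Literature.NumberTheory.EllipticCurves
  Literature.NumberTheory.EllipticCurves.ModularForms
  Literature.NumberTheory.EllipticCurves.Rank1Residual
  Literature.NumberTheory.EllipticCurves.Rank1Residual.Typed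
  Literature.NumberTheory.EllipticCurves.GreenbergVatsal2000
  Literature.NumberTheory.EllipticCurves.EmertonPollackWeston2006
  Literature.NumberTheory.GaloisRepresentations

namespace Summit.BirchSwinnertonDyer.BirchSwinnertonDyer.Theorems.AdditiveBranchIMCMultLowerCongruence

open Summit.BirchSwinnertonDyer.Rank1Residual
open Summit.BirchSwinnertonDyer.Rank1Residual.Additive
open Summit.BirchSwinnertonDyer.Rank1Residual.AdditivePotMult

variable {p : ℕ} [hp : Fact p.Prime]

/-! ## §1 The two shapes agree at a good ordinary curve -/

/-- The raw eigen-subgroup of the Kato-component binders IS the `χ_K`-eigen Selmer group of the half-eigen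
vocabulary: membership clauses `g_* t = if g ∈ Gal(ℚ̄/K) then t else −t` and `g_* t = ε(g) • t`,
`ε = (if · ∈ Gal(ℚ̄/K) then 1 else −1)`, coincide. [folklore] -/
theorem addSubgroup_eq_eigenSelmerGroupOver (V : WeierstrassCurve ℚ) (K : Type) [Field K] [NumberField K]
    [(galRange (K := ℚ) K).Normal] (κ : ZpExtension ℚ p) (U : Subgroup (Field.absoluteGaloisGroup ℚ))
    [U.Normal] (S : AddSubgroup (V.subgroupH1 p (κ.kerSubgroup ⊓ galRange (K := ℚ) K ⊓ U)))
    (hS : ∀ t, t ∈ S ↔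
      t ∈ V.selmerGroupOver p (κ.kerSubgroup ⊓ galRange (K := ℚ) K ⊓ U) ∧
        ∀ g ∈ κ.kerSubgroup, V.conjH1 p _ g t = if g ∈ galRange (K := ℚ) K then t else -t) :
    S = V.eigenSelmerGroupOver p (κ.kerSubgroup ⊓ galRange (K := ℚ) K ⊓ U) κ.kerSubgroup
      (fun g ↦ if g ∈ galRange (K := ℚ) K then 1 else -1) := by
  ext t
  rw [hS, ← chiEigenSelmerIn_eq_eigenSelmerGroupOver, mem_chiEigenSelmerIn_iff_ite]

/-- **Half-eigen shape ⟹ raw-binder shape, at a good ordinary `V`.** Given the raw datum `(S, X, toDual, …)`,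
`S` is the eigen-subgroup (previous lemma), so `(X, toDual, …)` IS an `EigenSelmerDualData`; the half-eigen
shape applied to it on the good-ordinary disjunct gives the raw conclusion verbatim.
[cite: EmertonPollackWeston2006, statement 5.1.1 (arXiv:math/0404484 p30) (two transcriptions of one statement)] -/
theorem branchCharIdealMuZeroEigen_of_halfEigen (V : WeierstrassCurve ℚ) [V.IsElliptic] [V.IsGloballyMinimal]
    (hord : IsOrdinaryAt V p) (h : BranchCharIdealMuZeroHalfEigen V p) : BranchCharIdealMuZeroEigen V p := by
  intro K _ _ _ F _ _ _ _ κ γ N _ f S hSγ X _ _ toDual hp2 hK2 hθ hκ hγ hcv hγK hγF hf hS hbij hT hC ϖ hϖ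
  have hSeq := addSubgroup_eq_eigenSelmerGroupOver V K κ (galRange (K := ℚ) F) S hS
  subst hSeq
  let D : V.EigenSelmerDualData p (κ.kerSubgroup ⊓ galRange (K := ℚ) K ⊓ galRange (K := ℚ) F)
      κ.kerSubgroup (fun g ↦ if g ∈ galRange (K := ℚ) K then 1 else -1) γ :=
    { X := X, conj_mem := hSγ, toDual := toDual, bijective := hbij, toDual_T_smul := hT,
      toDual_C_smul := hC }
  obtain ⟨htor, g, hspan, hunit, hι⟩ := h K F _ hp2 hK2 hθ (Or.inl ⟨hord, rfl⟩) hκ hγ hcv hγK hγF hf D ϖ hϖ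
  unfold EigenSelmerDualData.charIdeal at hspan
  exact ⟨htor, g, hspan, hunit, hι⟩

/-- **Raw-binder shape ⟹ half-eigen shape, at a good ordinary `V`.** Given a half-eigen datum `D` and a
branch `B` of the disjunction, `B` is the unit-root branch (the multiplicative disjuncts contradict good
reduction, `not_mult_of_good`), and the raw shape applied to `(eigenSelmerGroupOver, D.X, D.toDual, …)` with the
membership clause `mem_chiEigenSelmerIn_iff_ite` gives the half-eigen conclusion.
[cite: EmertonPollackWeston2006, statement 5.1.1 (arXiv:math/0404484 p30) (two transcriptions of one statement)] -/
theorem branchCharIdealMuZeroHalfEigen_of_eigen (V : WeierstrassCurve ℚ) [V.IsElliptic] [V.IsGloballyMinimal]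
    (hord : IsOrdinaryAt V p) (h : BranchCharIdealMuZeroEigen V p) : BranchCharIdealMuZeroHalfEigen V p := by
  intro K _ _ _ F _ _ _ _ κ γ N _ f B hp2 hK2 hθ hB hκ hγ hcv hγK hγF hf D ϖ hϖ
  have hBeq : B = if Even (p / 2) then padicLFunctionBranch f ((unitRoot V p : ℤ_[p]) : ℚ_[p]) (p / 2)
      else padicLFunctionMinusBranch f ((unitRoot V p : ℤ_[p]) : ℚ_[p]) (p / 2) := by
    rcases hB with h | h | h
    · exact h.2
    · exact absurd h.1.hasMultiplicativeReductionAtPrime (not_mult_of_good V p hord.1)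
    · exact absurd h.1 (not_mult_of_good V p hord.1)
  subst hBeq
  obtain ⟨htor, g, hspan, hunit, hι⟩ := h K F (κ := κ) (γ := γ) (f := f)
    (V.eigenSelmerGroupOver p (κ.kerSubgroup ⊓ galRange (K := ℚ) K ⊓ galRange (K := ℚ) F) κ.kerSubgroup
      (fun g ↦ if g ∈ galRange (K := ℚ) K then 1 else -1))
    D.conj_mem D.X D.toDual hp2 hK2 hθ hκ hγ hcv hγK hγF hf
    (fun t ↦ by
      rw [← chiEigenSelmerIn_eq_eigenSelmerGroupOver]; exact mem_chiEigenSelmerIn_iff_ite V K κ _ t)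
    D.bijective D.toDual_T_smul D.toDual_C_smul ϖ hϖ
  refine ⟨htor, g, ?_, hunit, hι⟩
  unfold EigenSelmerDualData.charIdeal
  exact hspan

/-- **The two shapes are equivalent at a good ordinary curve.**
[cite: EmertonPollackWeston2006, statement 5.1.1 (arXiv:math/0404484 p30) (two transcriptions of one statement)] -/
theorem branchCharIdealMuZeroHalfEigen_iff_eigen (V : WeierstrassCurve ℚ) [V.IsElliptic]
    [V.IsGloballyMinimal] (hord : IsOrdinaryAt V p) :
    BranchCharIdealMuZeroHalfEigen V p ↔ BranchCharIdealMuZeroEigen V p :=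
  ⟨branchCharIdealMuZeroEigen_of_halfEigen V hord, branchCharIdealMuZeroHalfEigen_of_eigen V hord⟩

/-! ## §2 A good ordinary partner of k1-c2's currency reaches a multiplicative twist model -/

/-- **k1-c2's partner, semistable target.** `hEPW'` (this seat's semistable transfer) + a good ordinary
partner `V₁` with `V₁[p]` irreducible satisfying k1-c2's raw shape (e.g. from
`branchCharIdealMuZeroEigen_of_katoComponent_of_LValueUnit`: Kato component reading + (C2′) on cell (G-ord,
`e = 2`)) + a `Γ_ℚ`-equivariant `V₁[p] ≃ V[p]` ⟹ `QuadraticBranchLowerDivisibilityAt V p` at ANY semistable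
`V`, in particular at the multiplicative twist model of a cell-(M) curve (§1 ∘ §2 of the parent file).
CONDITIONAL on the displayed inputs; closes nothing. [cite: EmertonPollackWeston2006, Cor. 5.1.4 (arXiv p30), Ex. 5.3.1 (p32)] -/
theorem quadraticBranchLowerDivisibilityAt_of_branchTransferSemistable_of_eigenPartner
    (hEPW : EmertonPollackWeston2006.cor514_branchTransfer_semistable_of_torsionIso) (hp5 : 5 ≤ p)
    (V₁ : WeierstrassCurve ℚ) [V₁.IsElliptic] [V₁.IsGloballyMinimal] (hord₁ : IsOrdinaryAt V₁ p)
    (hirr₁ : V₁.HasIrreducibleModPGaloisRep p) (hBr₁ : BranchCharIdealMuZeroEigen V₁ p)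
    (V : WeierstrassCurve ℚ) [V.IsElliptic] [V.IsGloballyMinimal]
    (hiso : ∃ e : geomTorsion V₁ (p : ℤ) ≃+ geomTorsion V (p : ℤ),
      ∀ (σ : Field.absoluteGaloisGroup ℚ) (P : geomTorsion V₁ (p : ℤ)), e (σ • P) = σ • e P) :
    QuadraticBranchLowerDivisibilityAt V p :=
  quadraticBranchLowerDivisibilityAt_of_branchTransferSemistable hEPW hp5 V₁ (Or.inl hord₁) hirr₁
    (branchCharIdealMuZeroHalfEigen_of_eigen V₁ hord₁ hBr₁) V hiso

end Summit.BirchSwinnertonDyer.BirchSwinnertonDyer.Theorems.AdditiveBranchIMCMultLowerCongruence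

end
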